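import Literature.AnabelianGeometry.EtaleTheta.Discharge.Sec5Prop55CarrierInputsGalois
import Literature.AnabelianGeometry.EtaleTheta.Discharge.Sec5Prop55EtaOfSaturation
import Literature.AnabelianGeometry.EtaleTheta.Discharge.Sec5RootCocycleDiesOfDictionary
import HarnessLib

/-!
# [EtTh] Prop. 5.5 / P55-L02: the descended tautological `η` at `ofBiKummerData` FROM SATURATION and FROM THE DICTIONARY, ON THE v2
# SUBQUOTIENT RECORD `ThetaSubquotientProjGalois` — PROOF-ONLY, proofs verbatim

S. Mochizuki, *The étale theta function and its Frobenioid-theoretic manifestations*, Publ. RIMS **45** (2009)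
[cite: MochizukiEtTh2009, Prop 5.5 proof p.327–328 (PDF pp.101–102); Prop 5.2 (iii) p.324 (PDF p.98); §5 p.327 (PDF p.101) «these subquotients determine subquotients `Aut_D(D) ↠ Aut^Θ_D(D)`»].
abc-iut cell, layer L2, seat abc-iut-w6-d020 (gen 7), row «(w4-S) V1→V2 PORT — deep EndKnit*/AllLeavesV3*/KummerComparisonInputsLevel*
heads» (abc-iut-L2-lead gen 7 R957; VNEXT-CENSUS-L2 §G5 add. 11 standing row «(w4)»), layer S2d = the two remaining `P`-binding η-producers (`Sec5Prop55EtaOfSaturation`, `Sec5RootCocycleDiesOfDictionary`).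

WHY.  abc-iut-w5-d123's `exists_eta_etaTautological_ofBiKummerData_of_saturation` (`hdies` from the two root-dies laws (D1)/(D2)) and abc-iut-L2-t11's
`exists_eta_etaTautological_ofBiKummerData_of_dictionary` (`hdies` from the dictionary `ThetaSectionCompat`; every other lemma of that file is `P`-free) bind
abc-iut-L2-t4's v1 record `(P : ThetaSubquotientProj 𝔉)` asks `proj_surjective` at EVERY base object and is EMPTY at the cell's root model for
`l` odd (abc-iut-L2-t9 p456572, kernel certificate p476337), so there each of these theorems quantifies over an empty type; abc-iut-w6-d079's v2
record `ThetaSubquotientProjGalois 𝔉 Gal` (p481123; surjectivity only at the objects singled out by `Gal`, as print uses it — Prop. 5.1 / Lemma 5.9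
run over connected GALOIS coverings) is INHABITED at every `ofSetting` carrier (p481568) and at every level stub of the junction data (p486065
`RigidData.nonempty_thetaSubquotientProjGalois_of_stub_eq_levelStub`); the v2 clauses `ThetaSubquotientProjGalois.IsKummerDetermined` /
`.CyclotomicRigidity` (p481123 / p484491) and the predicate twins `Thm56Sub.*Gal` (p484491) are the SAME formulas (they read `P` only through
`pre` / `proj` at `Base(B_N)`).

THIS FILE re-keys the listed theorems on the v2 record — binder `{Gal} (P : ThetaSubquotientProjGalois 𝔉 Gal)`, statements otherwise and
proofs VERBATIM (none of the source arguments uses `proj_surjective`), names = the originals with suffix `_galois`: 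
`exists_eta_etaTautological_ofBiKummerData_of_saturation_galois`, `exists_eta_etaTautological_ofBiKummerData_of_dictionary_galois` (⊢ `EtaTautologicalGal`) —
consuming abc-iut-w5-d013's carrier twin `exists_eta_etaTautological_ofBiKummerData_galois` (p487908) BY NAME.
0 `def`s; no v1 file is edited or restated (the `P`-free producers of the sources are consumed BY NAME); the v1 heads are the `P.toGalois Gal`
instances of these twins (abc-iut-w6-d079's `Iff.rfl` bridges `isKummerDetermined_toGalois_iff`, `cyclotomicRigidity_toGalois_iff`, `…Gal_toGalois_iff`).

HONEST FRAMING: a typing repair of the cell's OWN record (weaker quantifier on `P`, as print uses it); kernel-checked implications between typed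
statements over abc-iut-L2-t4's assembled §5 data; every named leaf / binder of the v1 heads stays NAMED exactly as there; nothing of [EtTh]
(a refereed paper) is asserted; the existence of the data for an actual curve is not claimed; typed ≠ discharged; nothing here bears on [IUTchIII]
Cor. 3.12 — no side taken; nothing here asserts abc proved or refuted.
-/

noncomputable section

namespace Literature.AnabelianGeometry.EtaleTheta

open CategoryTheory Opposite FrobenioidCyclotomicRigidity Literature.AlgebraicGeometry.Frobenioids
  Literature.AnabelianGeometry.SemiGraphs Literature.AnabelianGeometry.SemiGraphs.GaloisObjects

universe u₀ v₀ u v w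

namespace ThetaFrobenioid

/-! ### From saturation (abc-iut-w5-d123), v2 record -/

section Saturation

variable {K : Type u₀} [Field K]
  {X : SemiGraphs.TemperedArithmeticGroup.{u₀} K} {D₀ : Type u₀} [Category.{v₀} D₀]
  {V : FrdIMonoidStub.{w}} {T₀ : RealifiedDivisorMonoids (D₀ := D₀) V} {D : Type u} [Category.{v} D]
  {VD : FrdICatStub.{u, v, w} D} {S : BiKummerSetting X T₀ D VD}
  {pullFrac : ∀ {A A' : S.C} (_ : A' ⟶ A), S.biratUnits A → S.biratUnits A'}
  {lv N : ℕ+} {l' : ℕ} {RD : RigidData.{max v w} N l'} {θ : S.biratUnits S.Aodot} {Bl : S.C}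
  {Pl : S.FractionPair θ Bl} {Rl : S.NthRoot θ Pl lv pullFrac}
  (h : ModelFrobenioid.Hypotheses S.tf.divisorMonoid S.tf.ratFnFunctor)
  (toB : ∀ A : S.C, S.biratUnits A →* S.tf.biratUnitsModel A) (Q : FrobenioidTheta.ThetaSubquotientStub.{w} D)
  (odd_l : Odd (lv : ℕ)) (R : S.NthRoot Rl.root Rl.pair N pullFrac) (ιX : RD.PiX ≃ₜ* X.Pi)
  (hopen : IsOpen ((S.galoisSurj R.AN.base R.αData.isGalois).ker : Set X.Pi)) (σ : Aut R.AN.base →* Aut R.AN)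
  (K' : Type w) [Field K'] (constEmb : K'ˣ →* S.tf.biratUnitsModel R.BN)
  (constEmb_injective : Function.Injective constEmb)
  (hdivc : ∀ g : Aut R.BN.base,
    ModelFrobenioid.div ((σ ((BiKummerSetting.NthRoot.baseIso S R).conjAut.symm g)).hom ≫ R.pair.num) =
      ModelFrobenioid.div R.pair.num)
  (hdivp : ∀ y : RD.PiYdd,
    ModelFrobenioid.div ((σ (S.galoisSurj R.AN.base R.αData.isGalois (ιX y.1))).hom ≫ R.pair.den) =
      ModelFrobenioid.div R.pair.den)
  {Gal : D → Prop}

/-- (v2 record `ThetaSubquotientProjGalois`; the v1 theorem `exists_eta_etaTautological_ofBiKummerData_of_saturation` VERBATIM — binder type + twin names only.) **EtTh:Prop5.5/P55-L02 at the carrier, `η`-side from the saturation clauses of Def. 4.1 (iii)**: for the §5 data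
`𝔉 := ofBiKummerData …` over a §2 `RigidData` and a mod-`N` theta cocycle `η₀`, IF (D1) `Ker ρ ∩ Π^tp_Ÿ̲̲` acts
trivially on `μ_N` (Def. 4.1 (iii)(a): the base field of `A_N` is `μ_N`-saturated) and (D2) every mod-`N` theta
cocycle is, on `Ker ρ ∩ Π^tp_Ÿ̲̲`, a coboundary (Def. 4.1 (iii)(b): `f|_{A_N}` has an `N`-th root, read through Kummer
theory) — so that `η₀` dies on `Ker ρ ∩ Π^tp_Ÿ̲̲` by abc-iut-L6-t23's `ThetaEnvData.dies_on_ker_of` — and the subquotient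
datum `P` satisfies the row-2 laws `hlift`, `hP`, THEN there is an `η : H_{B_N} → (l·Δ_Θ)_{B_N} ⊗ ℤ/Nℤ` descending `η₀`
through `e` which is tautological on the `(l·Δ_Θ)_{B_N}`-part: `EtaTautologicalGal 𝔉 P η`.
[cite: MochizukiEtTh2009, Prop 5.5 proof p.327 (PDF p.101); Def 4.1 (iii) p.313 (PDF p.87)] -/
theorem exists_eta_etaTautological_ofBiKummerData_of_saturation_galois
    {η₀ : RD.PiYdd → RD.mu} (hη₀ : η₀ ∈ RD.thetaCocycles)
    (hD1 : ∀ k : RD.PiYdd, rhoOfBiKummerData R ιX (k : RD.PiX) = 1 →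
      RD.chi (RD.aug (k : RD.PiX)) = 1)
    (hD2 : ∀ η ∈ RD.thetaCocycles, ∃ c : RD.mu, ∀ k : RD.PiYdd, rhoOfBiKummerData R ιX (k : RD.PiX) = 1 →
      η k = CycEnvelope.coboundary (RD.aug.comp RD.PiYdd.subtype) RD.chi c k)
    (e : RD.mu → (ofBiKummerData h toB Q odd_l R ιX hopen σ K' constEmb constEmb_injective hdivc hdivp).lDeltaModN
      (ofBiKummerData h toB Q odd_l R ιX hopen σ K' constEmb constEmb_injective hdivc hdivp).BN)
    (P : ThetaSubquotientProjGalois (ofBiKummerData h toB Q odd_l R ιX hopen σ K' constEmb constEmb_injective hdivc hdivp) Gal)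
    (hlift : ∀ a ∈ (ofBiKummerData h toB Q odd_l R ιX hopen σ K' constEmb constEmb_injective hdivc hdivp).HB,
      a ∈ P.pre _ → ∃ k : RD.PiYdd, (k : RD.PiX) ∈ RD.lDeltaTheta ∧ rhoOfBiKummerData R ιX k = a)
    (hP : ∀ (k : RD.PiYdd) (hk : (k : RD.PiX) ∈ RD.lDeltaTheta) (hm : rhoOfBiKummerData R ιX k ∈ P.pre _),
      (QuotientGroup.mk (P.proj _ ⟨rhoOfBiKummerData R ιX k, hm⟩) :
          (ofBiKummerData h toB Q odd_l R ιX hopen σ K' constEmb constEmb_injective hdivc hdivp).lDeltaModN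
            (ofBiKummerData h toB Q odd_l R ιX hopen σ K' constEmb constEmb_injective hdivc hdivp).BN) =
        e (RD.thetaMod ⟨k, hk⟩)) :
    ∃ η : (ofBiKummerData h toB Q odd_l R ιX hopen σ K' constEmb constEmb_injective hdivc hdivp).HB →
        (ofBiKummerData h toB Q odd_l R ιX hopen σ K' constEmb constEmb_injective hdivc hdivp).lDeltaModN
          (ofBiKummerData h toB Q odd_l R ιX hopen σ K' constEmb constEmb_injective hdivc hdivp).BN,
      (∀ k : RD.PiYdd, η ⟨rhoOfBiKummerData R ιX k, Subgroup.mem_map_of_mem _ k.2⟩ = e (η₀ k)) ∧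
      Thm56Sub.EtaTautologicalGal (ofBiKummerData h toB Q odd_l R ιX hopen σ K' constEmb constEmb_injective hdivc hdivp)
        P η :=
  exists_eta_etaTautological_ofBiKummerData_galois h toB Q odd_l R ιX hopen σ K' constEmb constEmb_injective hdivc hdivp hη₀
    (RD.toThetaEnvData.dies_on_ker_of (rhoOfBiKummerData R ιX) hD1 hD2 η₀ hη₀) e P hlift hP

end Saturation

/-! ### From the dictionary (abc-iut-L2-t11), v2 record -/

section Dictionary

universe u₁ v₁ w₁

variable {K : Type u₀} [Field K] {X : SemiGraphs.TemperedArithmeticGroup.{u₀} K} {D₀ : Type u₀} [Category.{v₀} D₀]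
  {V : FrdIMonoidStub.{w₁}} {T₀ : RealifiedDivisorMonoids (D₀ := D₀) V} {D : Type u₁} [Category.{v₁} D]
  {VD : FrdICatStub.{u₁, v₁, w₁} D} {S : BiKummerSetting X T₀ D VD}
  {pullFrac : ∀ {A A' : S.C} (_ : A' ⟶ A), S.biratUnits A → S.biratUnits A'}
  {lv N : ℕ+} {l' : ℕ} {RD : RigidData.{max v₁ w₁} N l'} {θ : S.biratUnits S.Aodot} {Bl : S.C}
  {Pl : S.FractionPair θ Bl} {Rl : S.NthRoot θ Pl lv pullFrac}
  (h : ModelFrobenioid.Hypotheses S.tf.divisorMonoid S.tf.ratFnFunctor)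
  (toB : ∀ A : S.C, S.biratUnits A →* S.tf.biratUnitsModel A) (Q : FrobenioidTheta.ThetaSubquotientStub.{w₁} D)
  (odd_l : Odd (lv : ℕ)) (R : S.NthRoot Rl.root Rl.pair N pullFrac) (ιX : RD.PiX ≃ₜ* X.Pi)
  (hopen : IsOpen ((S.galoisSurj R.AN.base R.αData.isGalois).ker : Set X.Pi)) (σ : Aut R.AN.base →* Aut R.AN)
  (K' : Type w₁) [Field K'] (constEmb : K'ˣ →* S.tf.biratUnitsModel R.BN)
  (constEmb_injective : Function.Injective constEmb)
  (hdivc : ∀ g : Aut R.BN.base,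
    ModelFrobenioid.div ((σ ((BiKummerSetting.NthRoot.baseIso S R).conjAut.symm g)).hom ≫ R.pair.num) =
      ModelFrobenioid.div R.pair.num)
  (hdivp : ∀ y : RD.PiYdd,
    ModelFrobenioid.div ((σ (S.galoisSurj R.AN.base R.αData.isGalois (ιX y.1))).hom ≫ R.pair.den) =
      ModelFrobenioid.div R.pair.den)
  {Gal : D → Prop}

/-- (v2 record `ThetaSubquotientProjGalois`; the v1 theorem `exists_eta_etaTautological_ofBiKummerData_of_dictionary` VERBATIM — binder type + twin names only.) **EtTh:Prop5.5/P55-L02 at the carrier, `η`-side FROM THE DICTIONARY** (abc-iut-w5-d123's closer p418694 with its binder `hdies`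
DISCHARGED by `hdies_ofBiKummerData_of_thetaSectionCompat`): for the §5 data `𝔉 := ofBiKummerData …` over a §2 `RigidData RD` and a
mod-`N` theta cocycle `η₀` of the class satisfying the Prop. 5.2 (iii) dictionary, IF the subquotient datum `P` satisfies the row-2
laws `hlift`, `hP`, THEN there is an `η : H_{B_N} → (l·Δ_Θ)_{B_N} ⊗ ℤ/Nℤ` descending `η₀` through `e` which is tautological on the
`(l·Δ_Θ)_{B_N}`-part: `EtaTautologicalGal 𝔉 P η`.  Trust base on the `η`-side = {`η₀ ∈ thetaCocycles`, `ThetaSectionCompat … η₀`} —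
by abc-iut-f-116's `exists_thetaSectionCompat_mem_iff` exactly «the transported bi-Kummer difference cocycle lies in `η̲̈^Θ` mod `N`»,
the printed content of Prop. 5.2 (iii); no saturation binder, no bi-theta isomorphism.
[cite: MochizukiEtTh2009, Prop 5.5 proof p.327 (PDF p.101); Prop 5.2 (iii) p.324 (PDF p.98)] -/
theorem exists_eta_etaTautological_ofBiKummerData_of_dictionary_galois
    (H : (ofBiKummerData h toB Q odd_l R ιX hopen σ K' constEmb constEmb_injective hdivc hdivp).Facts)
    (m : (ofBiKummerData h toB Q odd_l R ιX hopen σ K' constEmb constEmb_injective hdivc hdivp).muTorsion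
        (ofBiKummerData h toB Q odd_l R ιX hopen σ K' constEmb constEmb_injective hdivc hdivp).BN
        (ofBiKummerData h toB Q odd_l R ιX hopen σ K' constEmb constEmb_injective hdivc hdivp).N ≃* RD.mu)
    (hYdd : (ofBiKummerData h toB Q odd_l R ιX hopen σ K' constEmb constEmb_injective hdivc hdivp).IdentifiesPiYdd
      RD.toThetaEnvData (MulEquiv.refl _))
    {η₀ : RD.PiYdd → RD.mu} (hη₀ : η₀ ∈ RD.thetaCocycles)
    (hcompat : (ofBiKummerData h toB Q odd_l R ιX hopen σ K' constEmb constEmb_injective hdivc hdivp).ThetaSectionCompat H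
      RD.toThetaEnvData (MulEquiv.refl _) m hYdd η₀)
    (e : RD.mu → (ofBiKummerData h toB Q odd_l R ιX hopen σ K' constEmb constEmb_injective hdivc hdivp).lDeltaModN
      (ofBiKummerData h toB Q odd_l R ιX hopen σ K' constEmb constEmb_injective hdivc hdivp).BN)
    (P : ThetaSubquotientProjGalois (ofBiKummerData h toB Q odd_l R ιX hopen σ K' constEmb constEmb_injective hdivc hdivp) Gal)
    (hlift : ∀ a ∈ (ofBiKummerData h toB Q odd_l R ιX hopen σ K' constEmb constEmb_injective hdivc hdivp).HB,
      a ∈ P.pre _ → ∃ k : RD.PiYdd, (k : RD.PiX) ∈ RD.lDeltaTheta ∧ rhoOfBiKummerData R ιX k = a)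
    (hP : ∀ (k : RD.PiYdd) (hk : (k : RD.PiX) ∈ RD.lDeltaTheta) (hm : rhoOfBiKummerData R ιX k ∈ P.pre _),
      (QuotientGroup.mk (P.proj _ ⟨rhoOfBiKummerData R ιX k, hm⟩) :
          (ofBiKummerData h toB Q odd_l R ιX hopen σ K' constEmb constEmb_injective hdivc hdivp).lDeltaModN
            (ofBiKummerData h toB Q odd_l R ιX hopen σ K' constEmb constEmb_injective hdivc hdivp).BN) =
        e (RD.thetaMod ⟨k, hk⟩)) :
    ∃ η : (ofBiKummerData h toB Q odd_l R ιX hopen σ K' constEmb constEmb_injective hdivc hdivp).HB →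
        (ofBiKummerData h toB Q odd_l R ιX hopen σ K' constEmb constEmb_injective hdivc hdivp).lDeltaModN
          (ofBiKummerData h toB Q odd_l R ιX hopen σ K' constEmb constEmb_injective hdivc hdivp).BN,
      (∀ k : RD.PiYdd, η ⟨rhoOfBiKummerData R ιX k, Subgroup.mem_map_of_mem _ k.2⟩ = e (η₀ k)) ∧
      Thm56Sub.EtaTautologicalGal (ofBiKummerData h toB Q odd_l R ιX hopen σ K' constEmb constEmb_injective hdivc hdivp)
        P η :=
  exists_eta_etaTautological_ofBiKummerData_galois h toB Q odd_l R ιX hopen σ K' constEmb constEmb_injective hdivc hdivp hη₀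
    (hdies_ofBiKummerData_of_thetaSectionCompat h toB Q odd_l R ιX hopen σ K' constEmb constEmb_injective hdivc hdivp H m hYdd
      hcompat) e P hlift hP

end Dictionary

end ThetaFrobenioid

end Literature.AnabelianGeometry.EtaleTheta

end
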